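import Summits.PneNP.PneNP.Theses.OneSlice
import Summits.PneNP.PneNP.Theorems.SingleThreshold.Negative.LoadBearing
import Literature.Computability.Complexity.RossmanMonotoneCliqueThm2Proofs
import Literature.Computability.Complexity.RossmanMonotoneCliqueFinite
import Literature.Computability.Complexity.GnpSprinkling

/-!
# Line `two-round-exposure` for crux `SingleThreshold` (stmt-PneNP-2833) — lead's RESHAPED skeleton
(exact-clique descent), v1

Route `OneSlice` (route-PneNP-OneSlice); crux `Summit.PneNP.PneNP.Theses.OneSlice.SingleThreshold`
(Rossman's single-threshold problem, unbounded-exponent form: `∀ c ∃ k ≥ 3 ∃ δ > 0 ∀ᶠ n`, every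
monotone `{∧₂,∨₂}`-circuit that is `δ`-accurate for `k`-CLIQUE on `G(n, n^{-2/(k-1)})` has more than
`n^c` gates). Lead prover-line-stmt-PneNP-2833-0, reshaping the planner skeleton
`Lines/two-round-exposure.lean` (crux-plan round 1) — SAME composition idea (two-round exposure ⇒
NoisyIndist ⇒ crux, same registered transfer `stub_twoRoundTransfer`), NEW decomposition of NoisyIndist.

**Idea.** Expose the critical graph in two rounds, `G(n,p) = H' ∪ S`, `S ∼ G(n,q)`,
`q = pMinus k ε n = n^{-2(1+ε)/(k-1)}` subcritical; the restriction `C^{H'}` of a small accurate `C`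
tells `S ∪ K_A` from `S` with constant advantage (`stub_twoRoundTransfer`, the lever, as filed and
triaged). NoisyIndist (no size-`n^c` monotone01 circuit has advantage `γ`, eventually, every `γ > 0`)
is decomposed along the EXACT CLIQUE MINTERM:
* for every MONOTONE `f`: `{f(S ∪ K_A) = 1, f(S) = 0} ⊆ {K_A is an exact minterm of f_S := f(S ∪ ·)}
  ∪ {f(S) = 0 ∧ ∃ e ∈ K_A, f(S ∪ (K_A − e)) = 1}` (contrapositive of `isMinterm_of_forall_update`);
  the second event has probability `≤ n^{-c₁}` because planting a `k`-clique MINUS AN EDGE at a random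
  position into `S` is invisible (second moment; every proper subgraph of `K_k` is strictly
  supercritical in `S` for `ε ≤ k⁻³`) — `stub_cliqueMinusEdgeInvisible`;
* pass from the circuit `D` to the structural ⋆-closed approximation `f̄` of its `{∧₂,∨₂}`-program
  (`stub_structuralApprox`, shared verbatim with line self-noise-closure): `D ≤ f̄` and Lemma 13;
* the EXACT clique minterm of `f̄_S` DESCENDS: through `∨̄ = (· ∨ ·)⋆`-gates for free (a closure-added
  `H ∈ I ∪ J` has `< k` non-isolated vertices, so it cannot carry `K_A`), through an `∧`-gate unless
  `K_A = M₁ ∪ M₂` SPLITS into two PROPER shifted minterms of the children; input wires never carry it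
  (`k ≥ 3`) — `stub_exactCliqueDescent` (deterministic);
* NEEDLE `stub_descentSplit`: a split at the end of an exact-clique descent from the output has
  vanishing probability for programs of length `≤ n^c`, `k ≥ k₀(c)`, `ε ≤ ε₀(k)` (≡ NoisyIndist for
  approximators; Rossman FOCS'10 §9 in this costume; the path condition is load-bearing: `n^{4.1}` junk
  gates `T_{θ₁}(E₁) ∧ T_{θ₂}(E₂)` each split w.p. `≈ 2/(Nq)`).

**Stubs (5, to be registered).** `stub_twoRoundTransfer` (M–L, as filed), `stub_cliqueMinusEdgeInvisible`
(M), `stub_structuralApprox` (M, = self-noise-closure stub 1), `stub_exactCliqueDescent` (M, pure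
combinatorics), `stub_descentSplit` (OPEN, hardest). Composition `NoisyIndist_of` and `SingleThreshold_of`
are sorry-free and use the stubs BY NAME. No definitions in this file (statements inlined over tree
vocabulary: `gnpWeight`, `gnpProb`, `kSubsetProb`, `cliqueVec`, `pMinus`, `tThr`, `smallI`, `medJ`,
`IsMinterm`, `starClosure`, `StarApproxInv`, `GateList.WF/OutOK/andGate/orGate`, `Circuit`,
`monotoneBasis(01)`, `Edges` from the landed `Negative/LoadBearing.lean`).
-/

noncomputable section

set_option linter.dupNamespace false

open Finset Filter
open scoped Classical Topology

namespace Summit.PneNP.PneNP.Cruxes.SingleThreshold.TwoRoundExposure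

open Literature.Computability.Complexity GateList
open Summit.PneNP.PneNP.Theorems.SingleThreshold.Negative (Edges gnpProb_union_le)

/-! ## Registered stubs (the ONLY `sorry`s of the line) -/

/-- **Stub A — two-round transfer (M–L, provable now; THE LEVER; verbatim from the planner skeleton).**
`NoisyIndist(c+1) → crux body(c)` at the same `k`: given `c, k ≥ 5, ε > 0`, if NO monotone
`{∧₂,∨₂,0,1}`-circuit of size `≤ n^{c+1}` distinguishes `S ∪ K_A` from `S` (`S ∼ G(n, pMinus k ε n)`,
`A` a uniform `k`-set) with advantage `γ`, eventually in `n`, for every `γ > 0`, then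
`∃ δ > 0 ∀ᶠ n ∀ C` monotone, `err_p(C) ≤ δ → n^c < |C|` (`p = n^{-2/(k-1)}`). Proof sketch: union law
`sum_sum_gnpWeight_mul_sup` with `p₁ = (p-q)/(1-q)`; for a `δ`-accurate monotone `C` of size `≤ n^c`,
`Pr_{G,A}[C(G ∪ K_A)=1] - Pr_G[C(G)=1] ≥ Pr[ω_k=0] - δ - δ/Pr[ω_k=1] - TV₂₃ ≥ c₀(k)/2` for `δ ≤ δ₀(k)`
(`sum_cliqueFree_mul_kSubsetProb_false_le`, `Rossman2010_plantedVsConditioned_holds`,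
`eventually_le_gnpProb_cliqueFree`, `eventually_le_gnpProb_cliqueCount_eq_one`), and the left side is the
`H'`-average of the advantages of `C^{H'}` (`Circuit.exists_restrict_sup`, size `≤ n^c + 1 ≤ n^{c+1}`),
each `≤ γ = c₀/4` eventually — contradiction. The bookkeeping of `Rossman2010_twoThresholds_of_thm1_lemma23`
with `H'` for `H`. [cite: Rossman2010, §7 and App. B (pp. 10, 13–14)] -/
theorem stub_twoRoundTransfer :
    ∀ (c k : ℕ) (ε : ℝ), 5 ≤ k → 0 < ε →
      (∀ γ : ℝ, 0 < γ →
      ∀ᶠ n : ℕ in atTop, ∀ D : Circuit (⊤ : SimpleGraph (Fin n)).edgeSet,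
        D.IsOver monotoneBasis01 → D.size ≤ n ^ (c + 1) →
          (∑ x : ((⊤ : SimpleGraph (Fin n)).edgeSet → Bool),
              gnpWeight n (pMinus k ε n) x *
                kSubsetProb n k (fun A => D.eval (x ⊔ cliqueVec A) = true)) -
            gnpProb n (pMinus k ε n) (univ.filter fun x => D.eval x = true) ≤ γ) →
      ∃ δ : ℝ, 0 < δ ∧ ∀ᶠ n : ℕ in Filter.atTop,
        ∀ C : Literature.Computability.Complexity.Circuit ((⊤ : SimpleGraph (Fin n)).edgeSet),
          C.IsOver Literature.Computability.Complexity.monotoneBasis →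
            (Finset.univ.filter (fun x : ((⊤ : SimpleGraph (Fin n)).edgeSet) → Bool =>
                C.eval x ≠ decide (¬ (SimpleGraph.fromEdgeSet {e : Sym2 (Fin n) |
                  ∃ h : e ∈ (⊤ : SimpleGraph (Fin n)).edgeSet, x ⟨e, h⟩ = true}).CliqueFree k))).sum
              (fun x => ((n : ℝ) ^ (-(2 : ℝ) / ((k : ℝ) - 1))) ^ (Finset.univ.filter (fun e => x e = true)).card *
                (1 - (n : ℝ) ^ (-(2 : ℝ) / ((k : ℝ) - 1))) ^
                  (n.choose 2 - (Finset.univ.filter (fun e => x e = true)).card)) ≤ δ →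
            n ^ c < C.size := by
  sorry

/-- **Stub B — a planted clique minus an edge is invisible (M, provable now).** For `k ≥ 5`,
`0 < ε ≤ k⁻³` there is `c₁ > 0` such that eventually in `n`, for every MONOTONE `f`:
`Pr_{S,A}[f(S) = 0 ∧ ∃ e ∈ K_A, f(S ∪ (K_A − e)) = 1] ≤ n^{-c₁}` (`S ∼ G(n, pMinus k ε n)`, `A` a
uniform `k`-set). Why true: by monotonicity and a union bound over the `C(k,2)` edges the left side is
`≤ (1/C(n,k)) Σ_{(A,e)} (E_S f(S ∪ (K_A−e)) − E_S f(S)) = C(k,2)·(E f(S ∪ Q) − E f(S))` for the planted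
family `Q = K_A − e`, `(A, e)` uniform; its likelihood ratio `L(z) = E_{(A,e)} q^{-|Q|}[Q ⊆ z]` has
`E_S L² − 1 = E_{(A,e),(A',e')}[q^{-|Q ∩ Q'|} − 1] ≤ Σ_{j=2}^{k-1} Pr[|A∩A'|=j]·q^{-C(j,2)} + Pr[A=A']·q^{-(C(k,2)-1)}`
`≤ O_k(n^{-2+2(1+ε)/(k-1)} + n^{-(1-ε(k-2))} + n^{-(2(1+ε)/(k-1) − εk)}) → 0` (every proper subgraph
of `K_k` is strictly supercritical in `S` for `ε ≤ k⁻³`), and `|E_planted f − E f| ≤ √(E L² − 1)`;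
`c₁ = 1/(4k)` works. (General form, same proof: any family `A ↦ Q_A < cliqueVec A`; the planner's
`stub_smallPattern` is the sub-case `2·supp(Q_A) < k`.) [cite: Rossman2010, Lemma 23 (App. B) for the
second-moment template; folklore] -/
theorem stub_cliqueMinusEdgeInvisible :
    ∀ k : ℕ, 5 ≤ k → ∀ ε : ℝ, 0 < ε → ε ≤ 1 / (k : ℝ) ^ 3 → ∃ c₁ : ℝ, 0 < c₁ ∧
      ∀ᶠ n : ℕ in atTop, ∀ f : (Edges n → Bool) → Bool, Monotone f →
        (∑ x : Edges n → Bool, gnpWeight n (pMinus k ε n) x *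
            kSubsetProb n k (fun A => f x = false ∧
              ∃ e, cliqueVec A e = true ∧ f (x ⊔ Function.update (cliqueVec A) e false) = true))
          ≤ (n : ℝ) ^ (-c₁) := by
  sorry

/-- **Stub C — the structural ⋆-closed approximation (M, provable now; verbatim the stub
`stub_structuralApprox` of line self-noise-closure).** For a bias `0 ≤ p ≤ 1`, a trigger `0 ≤ t < 1 − p`
and classes `I, J` with all single-coordinate vectors in `I` and `I ⊔ I ⊆ I ∪ J`, every well-formed
`{∧₂,∨₂}`-program `gs` has wire approximators `ap` which are (a) exact on inputs, (b) exact conjunctions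
at `∧`-gates, (c) the ⋆-closure (w.r.t. `(p, t, I ∪ J)`) of the disjunction at `∨`-gates, and (d) satisfy
`StarApproxInv` (monotone, ⋆-closed, dominating, Lemma 13 error, Lemma 14 locality). Why true: the
induction of the tree's `exists_closedApprox` (`StarApproxInv.nil` / `.snoc`) with the construction,
which that proof performs but does not export, recorded in the conclusion; earlier wires keep their
approximators when a gate is appended (`getD_vals_append_cons`), and every gate over `monotoneBasis` is
an `andGate` or an `orGate` (`exists_eq_andGate_of_fn_eq` / `exists_eq_orGate_of_fn_eq`).
[cite: Rossman2010, §5.2, Lemmas 13–14 (p. 8)] -/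
theorem stub_structuralApprox {ι : Type*} [Fintype ι] [DecidableEq ι] {p t : ℝ}
    (hp0 : 0 ≤ p) (hp1 : p ≤ 1) (ht : 0 ≤ t) (htp : t < 1 - p)
    {I J : Finset (ι → Bool)} (hI1 : ∀ i, indVec {i} ∈ I)
    (hIJ : ∀ x ∈ I, ∀ y ∈ I, x ⊔ y ∈ I ∪ J)
    (gs : List (Gate ι)) (hwf : GateList.WF gs) (hB : ∀ g ∈ gs, g.fn ∈ monotoneBasis) :
    ∃ ap : ι ⊕ ℕ → (ι → Bool) → Bool,
      (∀ i, ap (Sum.inl i) = fun x => x i) ∧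
      (∀ (m : ℕ) (u v : ι ⊕ ℕ), gs[m]? = some (GateList.andGate u v) →
          ap (Sum.inr m) = fun x => ap u x && ap v x) ∧
      (∀ (m : ℕ) (u v : ι ⊕ ℕ), gs[m]? = some (GateList.orGate u v) →
          ap (Sum.inr m) = starClosure p t (I ∪ J) (fun x => ap u x || ap v x)) ∧
      StarApproxInv p t I J gs ap := by
  sorry

/-- **Stub D — the exact clique minterm descends to a split (M, provable now; deterministic).**
For the structural approximators `ap` of a `{∧₂,∨₂}`-program `gs` (clauses (a)–(c) of stub C, any
bias/trigger, classes `smallI ∪ medJ`), a background `x` and a `k`-set `A` (`k ≥ 3`): if `K_A` is an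
exact minterm of the shifted output `y ↦ ap out (x ⊔ y)`, then there is a descent `out = w₀, …, w_r`
(each `w_{i+1}` a child of the gate `w_i`) along which `K_A` stays an exact minterm of every shifted
approximator, ending at an `∧`-gate `w_r = u ∧ v` at which `K_A` is an exact shifted minterm of
neither child (a SPLIT: `K_A = M₁ ∪ M₂` with proper shifted minterms, `IsMinterm.of_and`). Why true
(induction on the wire, `WF`): an input wire `y ↦ (x ⊔ y) i` is constant or has the single minterm
`indVec {i} ≠ cliqueVec A` (`#A ≥ 3`); at an `∨`-gate, a minterm `m₀` of `y ↦ (g ∨ ⋁_{h} Ind_h)(x ⊔ y)`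
is a minterm of `y ↦ g (x ⊔ y)` or satisfies `m₀ ≤ h` for an added `h` (take `y = m₀ ⊓ h`), and
`h ∈ smallI ∪ medJ` has `#supp h ≤ k − 1 < k = #supp (cliqueVec A)` (`mem_smallI`, `medJ_ineq`,
`supp_cliqueVec`, `supp_mono`) — so `K_A` descends to `u` or `v` (`IsMinterm.of_or`); at an `∧`-gate
it descends or splits by definition. [cite: Rossman2010, Observation 7 and Lemma 14 (pp. 6, 8); this line] -/
theorem stub_exactCliqueDescent {n k : ℕ} (hk : 3 ≤ k) {p t : ℝ}
    (gs : List (Gate (Edges n))) (ap : Edges n ⊕ ℕ → (Edges n → Bool) → Bool)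
    (hwf : GateList.WF gs) (hB : ∀ g ∈ gs, g.fn ∈ monotoneBasis)
    (hinl : ∀ i, ap (Sum.inl i) = fun x => x i)
    (hand : ∀ (m : ℕ) (u v : Edges n ⊕ ℕ), gs[m]? = some (GateList.andGate u v) →
        ap (Sum.inr m) = fun x => ap u x && ap v x)
    (hor : ∀ (m : ℕ) (u v : Edges n ⊕ ℕ), gs[m]? = some (GateList.orGate u v) →
        ap (Sum.inr m) = starClosure p t (smallI n k ∪ medJ n k) (fun x => ap u x || ap v x))
    (hmono : ∀ w, GateList.OutOK gs.length w → Monotone (ap w))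
    (x : Edges n → Bool) (A : Finset (Fin n)) (hA : #A = k)
    (out : Edges n ⊕ ℕ) (hout : GateList.OutOK gs.length out)
    (hmin : IsMinterm (fun y => ap out (x ⊔ y)) (cliqueVec A)) :
    ∃ (r m : ℕ) (u v : Edges n ⊕ ℕ) (w : ℕ → Edges n ⊕ ℕ),
      w 0 = out ∧ w r = Sum.inr m ∧ gs[m]? = some (GateList.andGate u v) ∧
      (∀ i, i < r → ∃ (m' : ℕ) (u' v' : Edges n ⊕ ℕ), w i = Sum.inr m' ∧
          (gs[m']? = some (GateList.andGate u' v') ∨ gs[m']? = some (GateList.orGate u' v')) ∧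
          (w (i + 1) = u' ∨ w (i + 1) = v')) ∧
      (∀ i, i ≤ r → IsMinterm (fun y => ap (w i) (x ⊔ y)) (cliqueVec A)) ∧
      ¬ IsMinterm (fun y => ap u (x ⊔ y)) (cliqueVec A) ∧
      ¬ IsMinterm (fun y => ap v (x ⊔ y)) (cliqueVec A) := by
  sorry

/-- **Stub E — DescentSplit (OPEN — the NEEDLE; hardest stub).** For every exponent `c` there is
`k₀` such that for all `k ≥ k₀` and all small `ε`: for every well-formed `{∧₂,∨₂}`-program `gs` of
length `≤ n^c`, output wire `out`, and its STRUCTURAL ⋆-closed approximation `ap` at the sprinkle bias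
`q = pMinus k ε n` (inputs exact, `∧` exact, `∨ ↦ (·∨·)⋆` w.r.t. `(q, tThr ε n, smallI ∪ medJ)`, hence
`StarApproxInv`), the probability over `(S, A)` (`S ∼ G(n,q)`, `A` a uniform `k`-set) that there is a
descent `out = w₀ → … → w_r` along which `K_A` is an EXACT minterm of every shifted approximator
`y ↦ ap (w i) (S ∪ y)`, ending at an `∧`-gate `w_r = u ∧ v` where `K_A` SPLITS (is an exact shifted
minterm of neither child), is eventually `≤ γ`, for every `γ > 0`. Why this is exactly what is left:
by stubs B–D every other way for the closed approximator to distinguish `S ∪ K_A` from `S` has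
vanishing probability, so the statement is equivalent (modulo B–D and Lemma 13) to NoisyIndist for the
programs' approximators, and it implies the crux through stub A. Why plausibly true: the event is
contained in the flip `{f̄(S ∪ K_A) = 1, f̄(S) = 0}` whose probability is the advantage of `f̄`; a PURE
threshold never splits (its shifted minterms are all `r`-sets, so `K_A` is a shifted minterm of one child
or of none); a split needs two complementary LOCALISATIONS of `K_A` in the two children (e.g.
`T_{θ₁}(E₁) ∧ T_{θ₂}(E₂)`, `E₁ ⊔ E₂` = all slots: rate `≈ 2/(Nq) = n^{-2+2(1+ε)/(k-1)}` per gate). Why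
it is hard: that per-gate rate makes the union bound over gates work exactly for `c < 2 − 2/(k−1)` (the
locality range of `Negative/Locality.lean`), and `n^{4.1}` junk split gates make the PATH-FREE version
false for `c ≥ 5`, so the proof must charge splits to the output along the descent (Rossman FOCS'10 §9,
the open single-threshold problem, in this costume; no catalogued barrier applies: monotone, average
case; `ApproximationMethodLimit` is for complete bases). [cite: Rossman2010, §9 (p. 11); this crux's
Lines/two-round-exposure.md, TRIAGE-r1-1..3] -/
theorem stub_descentSplit :
    ∀ c : ℕ, ∃ k₀ : ℕ, ∀ k : ℕ, k₀ ≤ k → ∃ ε₀ : ℝ, 0 < ε₀ ∧ ∀ ε : ℝ, 0 < ε → ε ≤ ε₀ →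
      ∀ γ : ℝ, 0 < γ → ∀ᶠ n : ℕ in atTop,
        ∀ (gs : List (Gate (Edges n))) (out : Edges n ⊕ ℕ)
          (ap : Edges n ⊕ ℕ → (Edges n → Bool) → Bool),
          GateList.WF gs → (∀ g ∈ gs, g.fn ∈ monotoneBasis) → gs.length ≤ n ^ c →
          GateList.OutOK gs.length out →
          (∀ i, ap (Sum.inl i) = fun x => x i) →
          (∀ (m : ℕ) (u v : Edges n ⊕ ℕ), gs[m]? = some (GateList.andGate u v) →
              ap (Sum.inr m) = fun x => ap u x && ap v x) →
          (∀ (m : ℕ) (u v : Edges n ⊕ ℕ), gs[m]? = some (GateList.orGate u v) →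
              ap (Sum.inr m) =
                starClosure (pMinus k ε n) (tThr ε n) (smallI n k ∪ medJ n k)
                  (fun x => ap u x || ap v x)) →
          StarApproxInv (pMinus k ε n) (tThr ε n) (smallI n k) (medJ n k) gs ap →
            (∑ x : Edges n → Bool, gnpWeight n (pMinus k ε n) x * kSubsetProb n k (fun A =>
                ∃ (r m : ℕ) (u v : Edges n ⊕ ℕ) (w : ℕ → Edges n ⊕ ℕ),
                  w 0 = out ∧ w r = Sum.inr m ∧ gs[m]? = some (GateList.andGate u v) ∧
                  (∀ i, i < r → ∃ (m' : ℕ) (u' v' : Edges n ⊕ ℕ), w i = Sum.inr m' ∧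
                      (gs[m']? = some (GateList.andGate u' v') ∨
                        gs[m']? = some (GateList.orGate u' v')) ∧
                      (w (i + 1) = u' ∨ w (i + 1) = v')) ∧
                  (∀ i, i ≤ r → IsMinterm (fun y => ap (w i) (x ⊔ y)) (cliqueVec A)) ∧
                  ¬ IsMinterm (fun y => ap u (x ⊔ y)) (cliqueVec A) ∧
                  ¬ IsMinterm (fun y => ap v (x ⊔ y)) (cliqueVec A))) ≤ γ := by
  sorry

/-! ## Glue lemmas (sorry-free) -/

/-- Shifting preserves monotonicity: `y ↦ f (x ⊔ y)` is monotone for monotone `f`. [folklore] -/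
theorem monotone_shift {n : ℕ} {f : (Edges n → Bool) → Bool} (hf : Monotone f) (x : Edges n → Bool) :
    Monotone fun y => f (x ⊔ y) :=
  fun _ _ h => hf (sup_le_sup_left h x)

/-- **The exact-minterm decomposition of the flip** (contrapositive of `isMinterm_of_forall_update`):
for monotone `f`, if `f (x ∪ K_A) = 1` then either `K_A` is an exact minterm of `y ↦ f (x ∪ y)` or some
`K_A − e` is already accepted on top of `x`. [folklore] -/
theorem isMinterm_or_exists_update {n : ℕ} {f : (Edges n → Bool) → Bool} (hf : Monotone f)
    (x : Edges n → Bool) (A : Finset (Fin n)) (h1 : f (x ⊔ cliqueVec A) = true) :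
    IsMinterm (fun y => f (x ⊔ y)) (cliqueVec A) ∨
      ∃ e, cliqueVec A e = true ∧ f (x ⊔ Function.update (cliqueVec A) e false) = true := by
  by_cases h : ∃ e, cliqueVec A e = true ∧ f (x ⊔ Function.update (cliqueVec A) e false) = true
  · exact Or.inr h
  · left
    push Not at h
    refine isMinterm_of_forall_update (monotone_shift hf x) h1 fun e he => ?_
    have := h e he
    simpa using this

/-- **Advantage ≤ exact-minterm mass + minus-an-edge mass**, pointwise in the background `x`, for a
monotone `f` (the `k`-sets are averaged by `kSubsetProb`; needs `k ≤ n` so that `Pr_A[True] = 1`).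
[folklore] -/
theorem kSubsetProb_flip_le {n k : ℕ} {f : (Edges n → Bool) → Bool} (hf : Monotone f)
    (x : Edges n → Bool) :
    kSubsetProb n k (fun A => f (x ⊔ cliqueVec A) = true) - (if f x = true then (1 : ℝ) else 0) ≤
      kSubsetProb n k (fun A => IsMinterm (fun y => f (x ⊔ y)) (cliqueVec A)) +
        kSubsetProb n k (fun A => f x = false ∧
          ∃ e, cliqueVec A e = true ∧ f (x ⊔ Function.update (cliqueVec A) e false) = true) := by
  have h0 := kSubsetProb_nonneg n k (fun A => IsMinterm (fun y => f (x ⊔ y)) (cliqueVec A))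
  have h0' := kSubsetProb_nonneg n k (fun A => f x = false ∧
    ∃ e, cliqueVec A e = true ∧ f (x ⊔ Function.update (cliqueVec A) e false) = true)
  by_cases hfx : f x = true
  · rw [if_pos hfx]
    have := kSubsetProb_le_one n k (fun A => f (x ⊔ cliqueVec A) = true)
    linarith
  · rw [if_neg hfx, sub_zero]
    have hfx' : f x = false := by simpa using hfx
    have h1 := kSubsetProb_le_add (n := n) (k := k) (fun A => f (x ⊔ cliqueVec A) = true)
      (fun A => IsMinterm (fun y => f (x ⊔ y)) (cliqueVec A))
    have h2 : kSubsetProb n k (fun A => f (x ⊔ cliqueVec A) = true ∧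
        ¬ IsMinterm (fun y => f (x ⊔ y)) (cliqueVec A)) ≤
        kSubsetProb n k (fun A => f x = false ∧
          ∃ e, cliqueVec A e = true ∧ f (x ⊔ Function.update (cliqueVec A) e false) = true) := by
      refine kSubsetProb_mono fun A hA => ⟨hfx', ?_⟩
      rcases isMinterm_or_exists_update hf x A hA.1 with h | h
      · exact absurd h hA.2
      · exact h
    linarith

/-- `Pr_q[f = 1] = Σ_x w_q(x)·[f x]`. [folklore] -/
theorem gnpProb_eq_sum_ite {n : ℕ} (q : ℝ) (f : (Edges n → Bool) → Bool) :
    gnpProb n q (univ.filter fun x => f x = true) =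
      ∑ x : Edges n → Bool, gnpWeight n q x * (if f x = true then (1 : ℝ) else 0) := by
  rw [gnpProb_filter]
  refine sum_congr rfl fun x _ => ?_
  split_ifs <;> simp

/-- **Advantage of a monotone `f` ≤ exact-minterm mass + minus-an-edge mass** (summed over the
background; `k ≤ n` is not needed). [folklore] -/
theorem adv_le_split_sum {n k : ℕ} {q : ℝ} (hq0 : 0 ≤ q) (hq1 : q ≤ 1)
    {f : (Edges n → Bool) → Bool} (hf : Monotone f) :
    (∑ x : Edges n → Bool, gnpWeight n q x * kSubsetProb n k (fun A => f (x ⊔ cliqueVec A) = true)) -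
        gnpProb n q (univ.filter fun x => f x = true) ≤
      (∑ x : Edges n → Bool, gnpWeight n q x *
          kSubsetProb n k (fun A => IsMinterm (fun y => f (x ⊔ y)) (cliqueVec A))) +
      (∑ x : Edges n → Bool, gnpWeight n q x * kSubsetProb n k (fun A => f x = false ∧
          ∃ e, cliqueVec A e = true ∧ f (x ⊔ Function.update (cliqueVec A) e false) = true)) := by
  rw [gnpProb_eq_sum_ite, ← sum_sub_distrib, ← sum_add_distrib]
  refine sum_le_sum fun x _ => ?_
  have hw := gnpWeight_nonneg hq0 hq1 x
  have h := kSubsetProb_flip_le (k := k) hf x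
  have := mul_le_mul_of_nonneg_left h hw
  linear_combination this

/-- `Pr[f = 1] ≤ Pr[g = 1] + Pr[f ≠ g]`. [folklore] -/
theorem gnpProb_true_le_add_ne {n : ℕ} {q : ℝ} (hq0 : 0 ≤ q) (hq1 : q ≤ 1)
    (f g : (Edges n → Bool) → Bool) :
    gnpProb n q (univ.filter fun x => f x = true) ≤
      gnpProb n q (univ.filter fun x => g x = true) + gnpProb n q (univ.filter fun x => f x ≠ g x) := by
  refine le_trans (gnpProb_mono hq0 hq1 ?_) (gnpProb_union_le hq0 hq1 _ _)
  intro x hx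
  simp only [mem_filter, mem_univ, true_and, mem_union] at hx ⊢
  by_cases hg : g x = true
  · exact Or.inl hg
  · right; rw [hx]; exact fun h => hg h.symm

/-- `kSubsetProb` is monotone in the event, tested on `k`-sets only. [folklore] -/
theorem kSubsetProb_mono_card {n k : ℕ} {P Q : Finset (Fin n) → Prop} [DecidablePred P]
    [DecidablePred Q] (h : ∀ A, #A = k → P A → Q A) : kSubsetProb n k P ≤ kSubsetProb n k Q := by
  unfold kSubsetProb
  refine div_le_div_of_nonneg_right ?_ (Nat.cast_nonneg _)
  exact_mod_cast card_le_card (fun A hA => by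
    rw [mem_filter] at hA ⊢
    exact ⟨hA.1, h A (mem_powersetCard.1 hA.1).2 hA.2⟩)

/-! ## Composition I (sorry-free): NoisyIndist from stubs B–E -/

/-- **NoisyIndist from stubs B, C, D, E** (kernel-checked glue): for every `c` there are `k ≥ 5` and
`ε > 0` such that for every `γ > 0`, eventually in `n`, every monotone `{∧₂,∨₂,0,1}`-circuit `D` of size
`≤ n^c` has advantage `≤ γ` between `S ∪ K_A` and `S`. Chain: `D` constant (advantage `0`) or a
`{∧₂,∨₂}`-program (`const_or_exists_monotone_circuit`); structural approximation `f̄` (stub C);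
`adv(D) ≤ adv(f̄) + Pr_q[f̄ ≠ D]` (`dom` + Lemma 13 `err`, `≤ n^c·#(I∪J)·e^{-n^ε} → 0`);
`adv(f̄) ≤ exact-minterm mass + minus-an-edge mass` (`adv_le_split_sum`); the first is a descent-split
mass (stub D) `≤ γ/2` (stub E), the second `≤ n^{-c₁}` (stub B). [folklore] -/
theorem NoisyIndist_of :
    ∀ c : ℕ, ∃ k : ℕ, 5 ≤ k ∧ ∃ ε : ℝ, 0 < ε ∧ ∀ γ : ℝ, 0 < γ →
      ∀ᶠ n : ℕ in atTop, ∀ D : Circuit (⊤ : SimpleGraph (Fin n)).edgeSet,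
        D.IsOver monotoneBasis01 → D.size ≤ n ^ c →
          (∑ x : ((⊤ : SimpleGraph (Fin n)).edgeSet → Bool),
              gnpWeight n (pMinus k ε n) x *
                kSubsetProb n k (fun A => D.eval (x ⊔ cliqueVec A) = true)) -
            gnpProb n (pMinus k ε n) (univ.filter fun x => D.eval x = true) ≤ γ := by
  intro c
  obtain ⟨k₀, hk₀⟩ := stub_descentSplit c
  set k : ℕ := max k₀ 5 with hkdef
  have hk5 : 5 ≤ k := le_max_right _ _
  have hkk₀ : k₀ ≤ k := le_max_left _ _
  obtain ⟨ε₀, hε₀, hE⟩ := hk₀ k hkk₀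
  have hk3 : (0 : ℝ) < 1 / (k : ℝ) ^ 3 := by positivity
  set ε : ℝ := min ε₀ (1 / (k : ℝ) ^ 3) with hεdef
  have hε0 : 0 < ε := lt_min hε₀ hk3
  have hεε₀ : ε ≤ ε₀ := min_le_left _ _
  have hεk : ε ≤ 1 / (k : ℝ) ^ 3 := min_le_right _ _
  obtain ⟨c₁, hc₁, hB⟩ := stub_cliqueMinusEdgeInvisible k hk5 ε hε0 hεk
  refine ⟨k, hk5, ε, hε0, fun γ hγ => ?_⟩
  -- eventually-facts
  have hEγ := hE ε hε0 hεε₀ (γ / 2) (by positivity)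
  have hlarge := eventually_largeN hk5 hε0 hεk 1 1 one_pos
  have hc₁ev : ∀ᶠ n : ℕ in atTop, (n : ℝ) ^ (-c₁) ≤ γ / 4 :=
    ((tendsto_rpow_neg_atTop hc₁).comp tendsto_natCast_atTop_atTop).eventually
      (eventually_le_nhds (by positivity))
  have hexp1 := eventually_poly_mul_exp_le (A := (2 : ℝ) ^ k.choose 2) (m := (c : ℝ) + k) (d := ε)
    (c' := ε / 2) hε0 (by linarith)
  have hexp2 : ∀ᶠ n : ℕ in atTop, Real.exp (-((n : ℝ) ^ (ε / 2))) ≤ γ / 2 := by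
    have h1 : Tendsto (fun n : ℕ => Real.exp (-((n : ℝ) ^ (ε / 2)))) atTop (𝓝 0) := by
      have := ((tendsto_rpow_atTop (by positivity : (0 : ℝ) < ε / 2)).comp
        tendsto_natCast_atTop_atTop)
      exact Real.tendsto_exp_atBot.comp (tendsto_neg_atTop_atBot.comp this)
    exact h1.eventually (eventually_le_nhds (by positivity))
  filter_upwards [hEγ, hB, hlarge, hc₁ev, hexp1, hexp2, eventually_ge_atTop 1]
    with n hEn hBn hLn hc₁n hexp1n hexp2n hn1
  intro D hD hDsize
  -- parameters at this `n`
  have hkn : k ≤ n := hLn.hkn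
  have hnr : (0 : ℝ) < n := by exact_mod_cast (show 0 < n by omega)
  set q : ℝ := pMinus k ε n with hqdef
  set t : ℝ := tThr ε n with htdef
  set K := smallI n k ∪ medJ n k with hKdef
  have hq0 : 0 < q := Real.rpow_pos_of_pos hnr _
  have hq1 : q ≤ 1 := by have := hLn.hp; rw [← hqdef] at this; linarith
  have ht0 : 0 < t := Real.exp_pos _
  have htq : t < 1 - q := by
    have h1 := hLn.hp; have h2 := hLn.ht
    rw [← hqdef] at h1; rw [← htdef] at h2
    linarith
  -- constant circuits have advantage `0`
  rcases const_or_exists_monotone_circuit D.gates D.output (wf_gates D) hD D.wf_output with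
    ⟨b, hb⟩ | ⟨C', hC', hsize', hC'eval⟩
  · have hDb : ∀ x, D.eval x = b := fun x => by rw [circuit_eval]; exact hb x
    cases b
    · have h1 : ∀ x : Edges n → Bool,
          kSubsetProb n k (fun A => D.eval (x ⊔ cliqueVec A) = true) = 0 := by
        intro x
        unfold kSubsetProb
        rw [filter_false_of_mem, card_empty, Nat.cast_zero, zero_div]
        intro A _; rw [hDb]; exact Bool.false_ne_true
      simp only [h1, mul_zero, sum_const_zero, zero_sub]
      have := gnpProb_nonneg hq0.le hq1 (univ.filter fun x : Edges n → Bool => D.eval x = true)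
      linarith
    · have h1 : ∀ x : Edges n → Bool,
          kSubsetProb n k (fun A => D.eval (x ⊔ cliqueVec A) = true) = 1 := by
        intro x
        rw [kSubsetProb_congr (Q := fun _ => True) (fun A => by simp [hDb]), kSubsetProb_true hkn]
      have h2 : gnpProb n q (univ.filter fun x : Edges n → Bool => D.eval x = true) = 1 := by
        rw [filter_true_of_mem (fun x _ => hDb x), gnpProb_univ]
      simp only [h1, mul_one, h2]
      rw [show (∑ x : Edges n → Bool, gnpWeight n q x) = gnpProb n q univ from rfl, gnpProb_univ]
      linarith
  -- the `{∧₂,∨₂}`-program and its structural closure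
  have hDeval : ∀ x, D.eval x = wireOf x (vals C'.gates x) C'.output := fun x => by
    rw [← circuit_eval C' x, hC'eval x, circuit_eval D x]
  set gs := C'.gates with hgs
  set out := C'.output with hout
  have hwf : WF gs := wf_gates C'
  have houtOK : OutOK gs.length out := C'.wf_output
  have hL : gs.length ≤ n ^ c := by
    have : C'.size ≤ D.size := hsize'
    exact le_trans this hDsize
  obtain ⟨ap, hinl, hand, hor, hap⟩ := stub_structuralApprox hq0.le hq1 ht0.le htq
    (fun e => indVec_singleton_mem_smallI (n := n) (k := k) hk5 e)
    (fun x hx y hy => sup_mem_smallI_union_medJ hx hy) gs hwf hC'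
  have hfm : Monotone (ap out) := hap.mono _ houtOK
  -- `D ≤ f̄` pointwise
  have hdom : ∀ x, D.eval x = true → ap out x = true := fun x hx => by
    rw [hDeval] at hx
    exact hap.dom _ houtOK x hx
  -- Lemma 13: `Pr_q[f̄ ≠ D] ≤ L·#K·t ≤ γ/4`
  have hKcard : (#K : ℝ) ≤ (n : ℝ) ^ (k : ℝ) * (2 : ℝ) ^ k.choose 2 := by
    have h1 := card_smallI_union_medJ_le (n := n) (k := k) hkn
    have h2 : (n.choose k : ℝ) ≤ (n : ℝ) ^ (k : ℝ) := by
      rw [Real.rpow_natCast]; exact_mod_cast Nat.choose_le_pow n k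
    calc (#K : ℝ) ≤ (n.choose k : ℝ) * (2 : ℝ) ^ k.choose 2 := by exact_mod_cast h1
      _ ≤ (n : ℝ) ^ (k : ℝ) * (2 : ℝ) ^ k.choose 2 :=
          mul_le_mul_of_nonneg_right h2 (by positivity)
  have herr : gnpProb n q (univ.filter fun x => ap out x ≠ D.eval x) ≤ γ / 4 := by
    have h1 : gnpProb n q (univ.filter fun x => ap out x ≠ D.eval x) ≤ gs.length * (#K * t) := by
      rw [gnpProb_filter_eq_prob]
      refine le_trans (prob_mono hq0.le hq1 fun x hx => ?_) hap.err
      by_contra hgood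
      have h := hap.agree hgood _ houtOK
      exact hx (by rw [hDeval x, h])
    have h2 : (gs.length : ℝ) * (#K * t) ≤
        (2 : ℝ) ^ k.choose 2 * (n : ℝ) ^ ((c : ℝ) + k) * Real.exp (-((n : ℝ) ^ ε)) := by
      have hLr : (gs.length : ℝ) ≤ (n : ℝ) ^ (c : ℝ) := by
        rw [Real.rpow_natCast]; exact_mod_cast hL
      have ht' : t = Real.exp (-((n : ℝ) ^ ε)) := rfl
      calc (gs.length : ℝ) * (#K * t) ≤ (n : ℝ) ^ (c : ℝ) * ((n : ℝ) ^ (k : ℝ) * (2 : ℝ) ^ k.choose 2 * t) := by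
            refine mul_le_mul hLr (mul_le_mul_of_nonneg_right hKcard ht0.le) (by positivity)
              (by positivity)
        _ = (2 : ℝ) ^ k.choose 2 * ((n : ℝ) ^ (c : ℝ) * (n : ℝ) ^ (k : ℝ)) * t := by ring
        _ = (2 : ℝ) ^ k.choose 2 * (n : ℝ) ^ ((c : ℝ) + k) * Real.exp (-((n : ℝ) ^ ε)) := by
            rw [← Real.rpow_add hnr, ht']
    have h3 : (1 : ℝ) / 2 * Real.exp (-((n : ℝ) ^ (ε / 2))) ≤ γ / 4 := by linarith
    linarith
  -- `adv(D) ≤ adv(f̄) + Pr[f̄ ≠ D]`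
  have hadv1 : (∑ x : Edges n → Bool, gnpWeight n q x *
        kSubsetProb n k (fun A => D.eval (x ⊔ cliqueVec A) = true)) ≤
      ∑ x : Edges n → Bool, gnpWeight n q x * kSubsetProb n k (fun A => ap out (x ⊔ cliqueVec A) = true) := by
    refine sum_le_sum fun x _ => mul_le_mul_of_nonneg_left ?_ (gnpWeight_nonneg hq0.le hq1 x)
    exact kSubsetProb_mono fun A hA => hdom _ hA
  have hadv2 : gnpProb n q (univ.filter fun x => ap out x = true) ≤
      gnpProb n q (univ.filter fun x => D.eval x = true) + γ / 4 :=
    (gnpProb_true_le_add_ne hq0.le hq1 (ap out) D.eval).trans (by linarith)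
  -- `adv(f̄) ≤ exact-minterm mass + minus-an-edge mass`
  have hsplit := adv_le_split_sum (k := k) (q := q) hq0.le hq1 hfm
  -- stub B: the minus-an-edge mass
  have hBfb := hBn (ap out) hfm
  -- stubs D + E: the exact-minterm mass is a descent-split mass
  have hDE : (∑ x : Edges n → Bool, gnpWeight n q x *
        kSubsetProb n k (fun A => IsMinterm (fun y => ap out (x ⊔ y)) (cliqueVec A))) ≤ γ / 2 := by
    refine le_trans (sum_le_sum fun x _ => mul_le_mul_of_nonneg_left
      (kSubsetProb_mono_card fun A hAk hA => ?_) (gnpWeight_nonneg hq0.le hq1 x))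
      (hEn gs out ap hwf hC' hL houtOK hinl hand hor hap)
    exact stub_exactCliqueDescent (by omega) gs ap hwf hC' hinl hand hor (fun w hw => hap.mono w hw)
      x A hAk out houtOK hA
  have hc₁n' : (n : ℝ) ^ (-c₁) ≤ γ / 4 := hc₁n
  linarith [hsplit, hBfb, hDE, hadv1, hadv2, herr]

/-! ## Composition II (sorry-free): the crux from stub A and NoisyIndist -/

/-- **`SingleThreshold` from the five registered stubs** (kernel-checked glue): the transfer
(stub A) applied at `c + 1` to NoisyIndist (`NoisyIndist_of`, stubs B–E). [folklore] -/
theorem SingleThreshold_of : Summit.PneNP.PneNP.Theses.OneSlice.SingleThreshold := by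
  intro c
  obtain ⟨k, hk, ε, hε, hN⟩ := NoisyIndist_of (c + 1)
  obtain ⟨δ, hδ, h⟩ := stub_twoRoundTransfer c k ε hk hε hN
  exact ⟨k, le_trans (by norm_num) hk, δ, hδ, h⟩

end Summit.PneNP.PneNP.Cruxes.SingleThreshold.TwoRoundExposure

end
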